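import Mathlib
import Summits.CriticalPhenomena.SAWScalingLimit.Theses.SAWDefectDecoherence
import Literature.Probability.RandomPlanarGeometry.HexParafermion
import Literature.Probability.RandomPlanarGeometry.HexSAW

/-!
# Sketch — crux idea `root-renewal-kesten` for `ObservableToSLER` (stmt-CriticalPhenomena-14005)

First lemmas of the line, typed over existing declarations (nothing proved here):

* `IsRenewalRow γ h` — the walk `γ` splits at row `h`: a prefix strictly below row `h`, a suffix at
  or above it (equivalently: exactly one edge of `γ` joins rows `h-1` and `h`);
* `RenewalFactorisation` — EXACT product structure at a renewal row (provable now): the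
  `x`-mass (any spin) of walks `a → z` with renewal row `h` is `Σ_p F_{Λ<h}(a → e_p) · F_{Λ≥h}(e_p → z)`
  over the crossing mid-edges `e_p`; the upper factor is the observable of the RAISED-FLOOR domain
  `Λ≥h` from the root `e_p` on its floor — an instance of the pinned hypothesis class;
* `RootRenewal` (RR, the a-priori input of the line) — for the critical walk from a source at
  depth `d` above an exact floor, to a far target, the mass of walks with NO renewal row among the
  rows `(m+d, m+2^K d]` is an `ε`-fraction of the total once `K = K(ε)`, uniformly in the domain
  beyond the flat patch;
* `NoDipRestriction` — exact: walks from an interior source that never dip below their starting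
  row are the walks of the raised-floor domain (restriction identity), the cheap special case.
-/

noncomputable section

namespace Summit.CriticalPhenomena.SAWScalingLimit.Cruxes.ObservableToSLER.RootRenewal

open Literature.Probability.RandomPlanarGeometry Literature.Probability.RandomPlanarGeometry.SAW
  Literature.Probability.LatticeModels
open scoped BigOperators
open Classical

/-- The row (second cell coordinate) of a honeycomb vertex; `{v | m ≤ row v}` is the exact
half-lattice of `HexObservableLimitR`'s pinned balls. -/
def row (v : HexVertex) : ℤ := v.1 1

/-- The part of `Λ` at or above row `h` (raised floor) and strictly below it (the cap). -/
def upper (Λ : Finset HexVertex) (h : ℤ) : Finset HexVertex := Λ.filter fun v => h ≤ row v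
def lower (Λ : Finset HexVertex) (h : ℤ) : Finset HexVertex := Λ.filter fun v => row v < h

/-- `γ` has a renewal at row `h`: its vertex list is a prefix strictly below row `h` followed by a
suffix at or above row `h` (both possibly empty only in degenerate cases we exclude by hypotheses). -/
def IsRenewalRow {Λ : Finset HexVertex} {a z : Sym2 HexVertex} (γ : HexMidEdgeSAW Λ a z) (h : ℤ) :
    Prop :=
  ∃ k : ℕ, (∀ v ∈ γ.verts.take k, row v < h) ∧ (∀ v ∈ γ.verts.drop k, h ≤ row v)

/-- Spin-`σ` mass of the walks `a → z` of `Λ` with NO renewal row in the window `(h₁, h₂]`. -/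
def noRenewalObs (Λ : Finset HexVertex) (a z : Sym2 HexVertex) (x σ : ℝ) (h₁ h₂ : ℤ) : ℂ :=
  ∑ γ : HexMidEdgeSAW Λ a z,
    if ∀ h : ℤ, h₁ < h → h ≤ h₂ → ¬ IsRenewalRow γ h then γ.weight x σ else 0

/-- Spin-`σ` mass of the walks `a → z` of `Λ` that DO have renewal row `h`. -/
def renewalObs (Λ : Finset HexVertex) (a z : Sym2 HexVertex) (x σ : ℝ) (h : ℤ) : ℂ :=
  ∑ γ : HexMidEdgeSAW Λ a z, if IsRenewalRow γ h then γ.weight x σ else 0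

/-- The critical two-point mass `Z_Λ(a → z)` (spin `0` observable). -/
def Z (Λ : Finset HexVertex) (a z : Sym2 HexVertex) : ℝ :=
  (hexParafermionicObservable Λ a hexCriticalFugacity 0 z).re

/-- EXACT RENEWAL FACTORISATION (first lemma, provable now, size M): at a renewal row the walk is
the concatenation of a walk of the cap `Λ<h` from `a` to the crossing mid-edge `e = {q, p}`
(`row q = h - 1`, `row p = h`) and a walk of the raised-floor domain `Λ≥h` from `e` to `z`; weights
multiply (lengths and windings add), and conversely every such pair concatenates to a walk of `Λ`
with renewal row `h` (the two pieces live in disjoint vertex sets). Stated for a source strictly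
below row `h` and a target at or above it. -/
def RenewalFactorisation : Prop :=
  ∀ (Λ : Finset HexVertex) (a z : Sym2 HexVertex) (x σ : ℝ) (h : ℤ),
    (∀ v ∈ a, row v < h) → (∀ v ∈ z, h ≤ row v) →
      renewalObs Λ a z x σ h =
        ∑ p ∈ (upper Λ h).filter (fun p => row p = h),
          ∑ q ∈ (lower Λ h).filter (fun q => hexGraph.Adj q p),
            hexParafermionicObservable (lower Λ h) a x σ s(q, p) *
              hexParafermionicObservable (upper Λ h) s(q, p) x σ z

/-- ROOT RENEWAL (RR) — the a-priori input. For every `ε > 0` there is a number of dyadic scales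
`K` such that for every source depth `d ≥ 1` and some patch radius `R₀ = R₀(ε, d)`: for every
simply connected `Λ` which is the exact half-lattice `{row ≥ m}` within distance `R₀` of the source
vertex `w` (at row `m + d`; the source mid-edge `{u, w}` may be interior), and every target mid-edge
`z` at distance `≥ R₀`, the critical mass of walks with no renewal row in `(m + d, m + 2^K d]` is at
most `ε` times the total critical mass. -/
def RootRenewal : Prop :=
  ∀ ε : ℝ, 0 < ε → ∃ K : ℕ, ∀ d : ℕ, 1 ≤ d → ∃ R₀ : ℝ, 0 < R₀ ∧
    ∀ (Λ : Finset HexVertex) (m : ℤ) (u w : HexVertex) (z : Sym2 HexVertex),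
      hexDomainSimplyConnected Λ → hexGraph.Adj u w → w ∈ Λ → row w = m + d →
      (∀ v : HexVertex, dist (hexCenter v) (hexCenter w) ≤ R₀ → (v ∈ Λ ↔ m ≤ row v)) →
      z ∈ hexDomainMidEdges Λ → (∀ v ∈ z, R₀ ≤ dist (hexCenter v) (hexCenter w)) →
        (noRenewalObs Λ s(u, w) z hexCriticalFugacity 0 (m + d) (m + 2 ^ K * d)).re
          ≤ ε * Z Λ s(u, w) z

/-- NO-DIP RESTRICTION (exact, provable now): the walks of `Λ` from a source on row `h` that never
visit a row `< h` are exactly the walks of the raised-floor domain `Λ≥h`; in observable form, for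
any spin. (The cheap special case of the line: conditioned on no dip, an interior source IS a
pinned-floor root.) -/
def NoDipRestriction : Prop :=
  ∀ (Λ : Finset HexVertex) (a z : Sym2 HexVertex) (x σ : ℝ) (h : ℤ),
    (∀ v ∈ a, h ≤ row v) →
      hexParafermionicObservable (upper Λ h) a x σ z =
        ∑ γ : HexMidEdgeSAW Λ a z, if ∀ v ∈ γ.verts, h ≤ row v then γ.weight x σ else 0

/-- Shape of the line's target inside the crux: the interior-endpoint clause of W2 for the flat
class. `FlatClassId` = identification for pinned boundary roots (output of the restriction lines);
the line proves `RootRenewal → FlatClassId → (identification for every endpoint approximation whose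
points stay inside the two flat balls)`. Typed here only as the implication skeleton over the route
decls. -/
def LineShape (FlatClassId InteriorEndpointId : Prop) : Prop :=
  Theses.SAWDefectDecoherence.HexObservableLimitR → Theses.SAWDefectDecoherence.HexTight →
    RootRenewal → FlatClassId → InteriorEndpointId

example : Theses.SAWDefectDecoherence.ObservableToSLER ↔
    (Theses.SAWDefectDecoherence.HexObservableLimitR → Theses.SAWDefectDecoherence.HexTight →
      ∀ (D : DobrushinDomain) (a b : ℝ → HexVertex),
        IsEmbEndpointApprox hexGraph hexCenter D a b →
          ConvergesInLawToSLE ((8 : NNReal) / 3) D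
            (fun δ (γ : HexDomainSAW D.carrier δ (a δ) (b δ)) => γ.curve)
            (fun δ => hexSAWLaw D.carrier δ (a δ) (b δ))) :=
  Iff.rfl

end Summit.CriticalPhenomena.SAWScalingLimit.Cruxes.ObservableToSLER.RootRenewal
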